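import Literature.Analysis.FluidPDE.BiotSavartIntegral
import Literature.Analysis.FluidPDE.BiotSavartNewtonKernel
import Literature.Analysis.FluidPDE.VorticityCalculus
import Literature.Analysis.FluidPDE.PressurePoisson
import HarnessLib

/-!
# The Biot–Savart integral against curl-type test fields

Analysis/FluidPDE support file (all results proved, no definitions) on the decomposition path of
the named fact `Literature.Analysis.FluidPDE.biotSavart_curl_eq_self` (`Vorticity.lean`;
Majda–Bertozzi, *Vorticity and Incompressible Flow*, §2.4.1 Prop. 2.16), a brick of
`Literature.Analysis.FluidPDE.MajdaBertozzi2002_holderEulerUniqueness`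
(`ElgindiAprioriBlowupProofs.lean`). The uniqueness argument (`DivCurlLiouvilleBounded.lean`) tests
irrotationality of `w = u − K₃ * curl u` weakly, against the curl-type fields
`(∂ₐg) c − (∂_c g) a` of the tree's annihilator lemmas; this file computes those pairings for
the two summands.

* Vector algebra: `u × (v × w) = ⟪u, w⟫v − ⟪u, v⟫w` (`cross_cross_right`), `curl (g V₀) = ∇g × V₀`
  (`curl_smul_const`), **the curl-type field is a curl**, `(∂ₐg) c − (∂_c g) a = curl (g (c × a))`
  (`curlPair_eq_curl_smul_cross`), `curl (G × V₀) = DG V₀ − (div G) V₀` (`curl_cross_const`) and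
  `curl (∇g × V₀) = D(∇g) V₀ − (Δg) V₀` (`curl_cross_gradient_const`, with the tree's
  `divergence_gradient`).
* For a `C¹` field `u`: `curl u` is weakly divergence free (`isWeaklyDivFree_curl`) and
  `∫ ⟪u, (∂ₐg) c − (∂_c g) a⟫ = ∫ g ⟪curl u, c × a⟫`
  (`integral_inner_curlPair_eq_integral_inner_curl_smul`; integration by parts for the curl,
  `VorticityCalculus.integral_inner_curl_eq_integral_inner_curl`).
* For `ω ∈ C ∩ L¹ ∩ L^∞`: **`(K₃ * (∇g × V₀))(y) = g(y) V₀ − ∫ ∂_{V₀}Γ(y − x) ∇g(x) dx`**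
  (`biotSavart_cross_gradient_const`: `K₃ * Φ = −Γ * curl Φ`, the curl formula above, the
  distributional gradient of `Γ` and Green's representation, all from
  `BiotSavartNewtonKernel.lean`), whence by symmetry of `K₃` (`BiotSavartIntegral.lean`)
  `∫ ⟪K₃ * ω, (∂ₐg) c − (∂_c g) a⟫ = ∫ g ⟪ω, c × a⟫ − ∫ ⟪ω(y), ∫ ∂_{c×a}Γ(y − x) ∇g(x) dx⟫ dy`
  (`integral_inner_biotSavart_curlPair_eq`). The last term vanishes for weakly divergence-free
  `ω` (its inner integral is the gradient of the Newtonian potential of `∂_{c×a}g`); that is the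
  next file.

## References

* A. J. Majda, A. L. Bertozzi, *Vorticity and Incompressible Flow* (CUP 2002), §1.1 (vector
  identities), §2.4.1 Prop. 2.16 (p. 63–64 of the held text). [MajdaBertozziCUP2002]
-/

noncomputable section

open MeasureTheory Set Filter Topology Function Metric InnerProductSpace
open scoped ENNReal NNReal RealInnerProductSpace Laplacian

namespace Literature.Analysis.FluidPDE

-- nested operator types
set_option maxSynthPendingDepth 3

/-! ### Vector algebra: curl-type fields are curls -/

/-- `u × (v × w) = ⟪u, w⟫ v − ⟪u, v⟫ w` ("BAC − CAB"; Mathlib's `cross_cross_eq_smul_sub_smul'`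
transported to `EuclideanSpace ℝ (Fin 3)`). [folklore] -/
theorem cross_cross_right (u v w : EuclideanSpace ℝ (Fin 3)) :
    cross u (cross v w) = ⟪u, w⟫ • v - ⟪u, v⟫ • w := by
  ext i
  fin_cases i <;>
  simp only [cross, PiLp.inner_apply, RCLike.inner_apply, conj_trivial, Fin.sum_univ_three,
    cross_apply, Matrix.cons_val_zero, Matrix.cons_val_one, Matrix.cons_val_two,
    Matrix.head_cons, Matrix.tail_cons, PiLp.sub_apply, PiLp.smul_apply, smul_eq_mul] <;>
  simp <;> ring

/-- The Fréchet derivative of a real function is the inner product with its gradient: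
`Dg(x) = ⟪∇g(x), ·⟫`. [folklore] -/
theorem fderiv_eq_innerSL_gradient (g : EuclideanSpace ℝ (Fin 3) → ℝ) (x : EuclideanSpace ℝ (Fin 3)) :
    fderiv ℝ g x = innerSL ℝ (gradient g x) := by
  ext v
  rw [innerSL_apply_apply, gradient, InnerProductSpace.toDual_symm_apply]

/-- `⟪∇g(x), a⟫ = ∂ₐg(x)`. [folklore] -/
theorem inner_gradient_left (g : EuclideanSpace ℝ (Fin 3) → ℝ) (x a : EuclideanSpace ℝ (Fin 3)) :
    ⟪gradient g x, a⟫ = fderiv ℝ g x a := by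
  rw [gradient, InnerProductSpace.toDual_symm_apply]

/-- **`curl (g V₀) = ∇g × V₀`** for a constant vector `V₀` and `g` differentiable at `x`
(Majda–Bertozzi, §1.1 vector identities). [folklore] -/
theorem curl_smul_const {g : EuclideanSpace ℝ (Fin 3) → ℝ} {x : EuclideanSpace ℝ (Fin 3)}
    (hg : DifferentiableAt ℝ g x) (V₀ : EuclideanSpace ℝ (Fin 3)) :
    curl (fun y => g y • V₀) x = cross (gradient g x) V₀ := by
  rw [curl_smul hg (differentiableAt_const V₀), curl_eq_zero_of_fderiv_eq_zero (by simp),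
    smul_zero, zero_add, fderiv_eq_innerSL_gradient, curlCLM_smulRight_innerSL]

/-- **Curl-type test fields are curls**: `(∂ₐg) c − (∂_c g) a = curl (g (c × a))` at every point
of differentiability of `g` (`∇g × (c × a) = ⟪∇g, a⟫ c − ⟪∇g, c⟫ a`). The curl-type fields are
those against which the tree's `div`–`curl` annihilator lemmas test irrotationality
(`DivCurlAnnihilator.lean`). [folklore] -/
theorem curlPair_eq_curl_smul_cross {g : EuclideanSpace ℝ (Fin 3) → ℝ} {x : EuclideanSpace ℝ (Fin 3)}
    (hg : DifferentiableAt ℝ g x) (a c : EuclideanSpace ℝ (Fin 3)) :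
    fderiv ℝ g x a • c - fderiv ℝ g x c • a = curl (fun y => g y • cross c a) x := by
  rw [curl_smul_const hg, cross_cross_right, inner_gradient_left, inner_gradient_left]

/-- **`curl (G × V₀) = DG V₀ − (div G) V₀`** for a constant vector `V₀` and a field `G`
differentiable at `x` (the case `w = const` of `curl (v × w) = v div w − w div v + (w·∇)v − (v·∇)w`,
Majda–Bertozzi, §1.1). [folklore] -/
theorem curl_cross_const {G : EuclideanSpace ℝ (Fin 3) → EuclideanSpace ℝ (Fin 3)}
    {x : EuclideanSpace ℝ (Fin 3)} (hG : DifferentiableAt ℝ G x) (V₀ : EuclideanSpace ℝ (Fin 3)) :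
    curl (fun y => cross (G y) V₀) x = fderiv ℝ G x V₀ - (VectorCalculus.divergence G x) • V₀ := by
  rw [curl_eq_curlCLM, (hasFDerivAt_cross hG.hasFDerivAt (hasFDerivAt_const V₀ x)).fderiv,
    divergence_eq_sum_inner_fderiv (EuclideanSpace.basisFun (Fin 3) ℝ)]
  have hV : fderiv ℝ G x V₀ = ∑ m, V₀ m • fderiv ℝ G x (EuclideanSpace.single m 1) := by
    conv_lhs => rw [show V₀ = ∑ m, V₀ m • EuclideanSpace.single m (1 : ℝ) by
      simpa using ((EuclideanSpace.basisFun (Fin 3) ℝ).sum_repr V₀).symm]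
    simp [map_sum, map_smul]
  rw [hV]
  ext i
  fin_cases i <;>
  simp [curlCLM_apply, Fin.sum_univ_three, cross, cross_apply, EuclideanSpace.basisFun_apply,
    PiLp.inner_apply] <;> ring

/-- For `g ∈ C²`: `curl (∇g × V₀) = D(∇g) V₀ − (Δg) V₀` (`div ∇g = Δg`, the tree's
`divergence_gradient`). Hence `curl curl (g V₀) = D(∇g)V₀ − (Δg)V₀`. [folklore] -/
theorem curl_cross_gradient_const {g : EuclideanSpace ℝ (Fin 3) → ℝ} (hg : ContDiff ℝ 2 g)
    (x V₀ : EuclideanSpace ℝ (Fin 3)) :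
    curl (fun y => cross (gradient g y) V₀) x = fderiv ℝ (gradient g) x V₀ - (Δ g) x • V₀ := by
  have hd : DifferentiableAt ℝ (gradient g) x :=
    ((InnerProductSpace.toDual ℝ (EuclideanSpace ℝ (Fin 3))).symm.differentiable.comp
      ((hg.fderiv_right (m := 1) le_rfl).differentiable one_ne_zero)) x
  rw [curl_cross_const hd, divergence_gradient hg]


/-! ### Weak divergence-freeness and the curl-type pairing for a `C¹` field -/

section Classical

variable {u : EuclideanSpace ℝ (Fin 3) → EuclideanSpace ℝ (Fin 3)}

/-- **The curl of a `C¹` field is weakly divergence free**: `∫ ⟪curl u, ∇θ⟫ = ∫ ⟪u, curl ∇θ⟫ = 0`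
for every test function `θ` (integration by parts for the curl, the tree's
`integral_inner_curl_eq_integral_inner_curl`, and `curl ∇ = 0`). For `u ∈ C²` this is
`div curl u = 0` pointwise; here `curl u` is merely continuous. [folklore] -/
theorem isWeaklyDivFree_curl (hu : ContDiff ℝ 1 u) : IsWeaklyDivFree (curl u) := by
  intro θ hθ
  have hθ2 : ContDiff ℝ 2 θ := contDiff_infty.1 hθ.contDiff 2
  have hg1 : ContDiff ℝ 1 (gradient θ) :=
    (InnerProductSpace.toDual ℝ (EuclideanSpace ℝ (Fin 3))).symm.contDiff.comp
      (hθ2.fderiv_right (m := 1) le_rfl)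
  have hgc : HasCompactSupport (gradient θ) :=
    (hθ.hasCompactSupport.fderiv (𝕜 := ℝ)).comp_left
      (g := (InnerProductSpace.toDual ℝ (EuclideanSpace ℝ (Fin 3))).symm) (map_zero _)
  rw [integral_inner_curl_eq_integral_inner_curl hu hg1 hgc]
  have h0 : ∀ x, curl (gradient θ) x = 0 := fun x => curl_gradient_eq_zero_holds θ hθ2 x
  simp [h0]

/-- **The curl-type pairing of a `C¹` field**: `∫ ⟪u, (∂ₐg) c − (∂_c g) a⟫ = ∫ g ⟪curl u, c × a⟫`
(the test field is `curl (g (c × a))`, `curlPair_eq_curl_smul_cross`, and the curl is formally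
self-adjoint). [folklore] -/
theorem integral_inner_curlPair_eq_integral_inner_curl_smul (hu : ContDiff ℝ 1 u)
    {g : EuclideanSpace ℝ (Fin 3) → ℝ} (hg : ContDiff ℝ 1 g) (hgc : HasCompactSupport g)
    (a c : EuclideanSpace ℝ (Fin 3)) :
    ∫ x, ⟪u x, fderiv ℝ g x a • c - fderiv ℝ g x c • a⟫ =
      ∫ x, ⟪curl u x, g x • cross c a⟫ := by
  have hΨ : ContDiff ℝ 1 fun y => g y • cross c a := hg.smul contDiff_const
  have hΨc : HasCompactSupport fun y => g y • cross c a := hgc.smul_right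
  have e : ∀ x, fderiv ℝ g x a • c - fderiv ℝ g x c • a = curl (fun y => g y • cross c a) x :=
    fun x => curlPair_eq_curl_smul_cross (hg.differentiable one_ne_zero x) a c
  simp_rw [e]
  exact (integral_inner_curl_eq_integral_inner_curl hu hΨ hΨc).symm

end Classical

/-! ### The Biot–Savart integral of `∇g × V₀` and the curl-type pairing of `K₃ * ω` -/

section BiotSavart

variable {g : EuclideanSpace ℝ (Fin 3) → ℝ} {V₀ : EuclideanSpace ℝ (Fin 3)}

/-- Regularity of `x ↦ ∇g(x) × V₀` for `g ∈ C²_c`: it is `C¹` with compact support. [folklore] -/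
theorem contDiff_cross_gradient_const (hg : ContDiff ℝ 2 g) (V₀ : EuclideanSpace ℝ (Fin 3)) :
    ContDiff ℝ 1 fun x => cross (gradient g x) V₀ := by
  have hg1 : ContDiff ℝ 1 (gradient g) :=
    (InnerProductSpace.toDual ℝ (EuclideanSpace ℝ (Fin 3))).symm.contDiff.comp
      (hg.fderiv_right (m := 1) le_rfl)
  exact (crossCLM.contDiff.comp hg1).clm_apply contDiff_const

/-- Compact support of `x ↦ ∇g(x) × V₀` for compactly supported `g`. [folklore] -/
theorem hasCompactSupport_cross_gradient_const (hgc : HasCompactSupport g)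
    (V₀ : EuclideanSpace ℝ (Fin 3)) : HasCompactSupport fun x => cross (gradient g x) V₀ := by
  have hgc' : HasCompactSupport (gradient g) :=
    (hgc.fderiv (𝕜 := ℝ)).comp_left
      (g := (InnerProductSpace.toDual ℝ (EuclideanSpace ℝ (Fin 3))).symm) (map_zero _)
  refine hgc'.mono fun x hx => ?_
  contrapose! hx
  simp only [mem_support, not_not] at hx
  simp [← crossCLM_apply, hx]

/-- **The Biot–Savart integral of `∇g × V₀`** (`g` a test function, `V₀` constant):
`(K₃ * (∇g × V₀))(y) = g(y) V₀ − ∫ ∂_{V₀}Γ(y − x) ∇g(x) dx`. Proof: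
`K₃ * Φ = −Γ * curl Φ` (`biotSavart_eq_neg_integral_newtonKernel_smul_curl`),
`curl (∇g × V₀) = D(∇g)V₀ − (Δg)V₀` (`curl_cross_gradient_const`), the distributional-gradient
identity `∫ Γ(y−x) D(∇g)(x)V₀ = ∫ ∂_{V₀}Γ(y−x) ∇g(x)` (`integral_newtonKernel_smul_fderiv_eq`) and
Green's representation `∫ Γ(y−x) Δg(x) = g(y)` (`integral_newtonKernel_mul_laplacian`). [folklore] -/
theorem biotSavart_cross_gradient_const (hg : ContDiff ℝ (⊤ : ℕ∞) g) (hgc : HasCompactSupport g)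
    (V₀ y : EuclideanSpace ℝ (Fin 3)) :
    biotSavart (fun x => cross (gradient g x) V₀) y =
      g y • V₀ - ∫ x, (fderiv ℝ newtonKernel (y - x) V₀) • gradient g x := by
  have hg2 : ContDiff ℝ 2 g := contDiff_infty.1 hg 2
  have hg1 : ContDiff ℝ 1 (gradient g) :=
    (InnerProductSpace.toDual ℝ (EuclideanSpace ℝ (Fin 3))).symm.contDiff.comp
      (hg2.fderiv_right (m := 1) le_rfl)
  have hgc' : HasCompactSupport (gradient g) :=
    (hgc.fderiv (𝕜 := ℝ)).comp_left
      (g := (InnerProductSpace.toDual ℝ (EuclideanSpace ℝ (Fin 3))).symm) (map_zero _)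
  rw [biotSavart_eq_neg_integral_newtonKernel_smul_curl (contDiff_cross_gradient_const hg2 V₀)
    (hasCompactSupport_cross_gradient_const hgc V₀)]
  simp_rw [curl_cross_gradient_const hg2]
  -- split the integral
  have hΔc : HasCompactSupport (Δ g) := hgc.mono' fun x hx => by
    by_contra h
    exact hx (FluidPDE.laplacian_eq_zero_of_notMem_tsupport h)
  have i1 : Integrable fun x => newtonKernel (y - x) • fderiv ℝ (gradient g) x V₀ :=
    integrable_newtonKernel_smul ((hg1.continuous_fderiv one_ne_zero).clm_apply continuous_const)
      (hgc'.fderiv_apply (𝕜 := ℝ) V₀) y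
  have i2 : Integrable fun x => newtonKernel (y - x) • ((Δ g) x • V₀) :=
    integrable_newtonKernel_smul ((FluidPDE.continuous_laplacian hg2).smul continuous_const)
      hΔc.smul_right y
  simp_rw [smul_sub]
  rw [integral_sub i1 i2, integral_newtonKernel_smul_fderiv_eq hg1 hgc' y V₀, neg_sub]
  congr 1
  simp_rw [smul_smul]
  rw [integral_smul_const, integral_newtonKernel_mul_laplacian hg2 hgc y]

variable {ω : EuclideanSpace ℝ (Fin 3) → EuclideanSpace ℝ (Fin 3)} {C : ℝ}

/-- **The curl-type pairing of a Biot–Savart velocity.** For `ω ∈ C ∩ L¹ ∩ L^∞`, a test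
function `g` and `a, c`:
`∫ ⟪K₃ * ω, (∂ₐg) c − (∂_c g) a⟫ = ∫ g ⟪ω, c × a⟫ − ∫ ⟪ω(y), ∫ ∂_{c×a}Γ(y − x) ∇g(x) dx⟫ dy`
(symmetry of `K₃`, `integral_inner_biotSavart_eq`, and the previous formula with `V₀ = c × a`).
The first term is the curl-type pairing of any `C¹` field with curl `ω`
(`integral_inner_curlPair_eq_integral_inner_curl_smul`); the second vanishes when `ω` is weakly
divergence free (the inner integral is a gradient), which is proved in the sequel. [folklore] -/
theorem integral_inner_biotSavart_curlPair_eq (hωc : Continuous ω) (hωi : Integrable ω)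
    (hωb : ∀ y, ‖ω y‖ ≤ C) (hg : ContDiff ℝ (⊤ : ℕ∞) g) (hgc : HasCompactSupport g)
    (a c : EuclideanSpace ℝ (Fin 3)) :
    ∫ x, ⟪biotSavart ω x, fderiv ℝ g x a • c - fderiv ℝ g x c • a⟫ =
      (∫ y, ⟪ω y, g y • cross c a⟫) -
        ∫ y, ⟪ω y, ∫ x, (fderiv ℝ newtonKernel (y - x) (cross c a)) • gradient g x⟫ := by
  have hg2 : ContDiff ℝ 2 g := contDiff_infty.1 hg 2
  set V₀ : EuclideanSpace ℝ (Fin 3) := cross c a with hV₀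
  -- the test field is `∇g × V₀`
  have e : ∀ x, fderiv ℝ g x a • c - fderiv ℝ g x c • a = cross (gradient g x) V₀ := fun x => by
    rw [curlPair_eq_curl_smul_cross (hg2.differentiable (by norm_num) x) a c,
      curl_smul_const (hg2.differentiable (by norm_num) x)]
  simp_rw [e]
  -- symmetry of the Biot–Savart operator
  have hΦ : Continuous fun x => cross (gradient g x) V₀ := (contDiff_cross_gradient_const hg2 V₀).continuous
  have hΦc := hasCompactSupport_cross_gradient_const hgc V₀
  rw [integral_inner_biotSavart_eq hωc hωi hωb hΦ hΦc]
  simp_rw [biotSavart_cross_gradient_const hg hgc V₀, inner_sub_right]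
  -- integrability of the two pairings (the second integrand is `⟪ω, g V₀ − K₃ * (∇g × V₀)⟫`)
  obtain ⟨CΦ, hCΦ⟩ := hΦ.bounded_above_of_compact_support hΦc
  have hΦi : Integrable (fun x => cross (gradient g x) V₀) := hΦ.integrable_of_hasCompactSupport hΦc
  obtain ⟨G, hG⟩ := hg.continuous.bounded_above_of_compact_support hgc
  have i1 : Integrable fun y => ⟪ω y, g y • V₀⟫ := by
    refine (hωi.norm.mul_const (G * ‖V₀‖)).mono'
      (hωc.inner (hg.continuous.smul continuous_const)).aestronglyMeasurable
      (Eventually.of_forall fun y => ?_)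
    refine (norm_inner_le_norm _ _).trans ?_
    rw [norm_smul]
    exact mul_le_mul_of_nonneg_left (mul_le_mul_of_nonneg_right (hG y) (norm_nonneg _))
      (norm_nonneg _)
  have hP : ∀ y, ∫ x, (fderiv ℝ newtonKernel (y - x) V₀) • gradient g x =
      g y • V₀ - biotSavart (fun x => cross (gradient g x) V₀) y := fun y => by
    rw [biotSavart_cross_gradient_const hg hgc V₀ y, sub_sub_cancel]
  have i2 : Integrable fun y => ⟪ω y, ∫ x, (fderiv ℝ newtonKernel (y - x) V₀) • gradient g x⟫ := by
    simp_rw [hP]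
    have hc2 : Continuous fun y => g y • V₀ - biotSavart (fun x => cross (gradient g x) V₀) y :=
      (hg.continuous.smul continuous_const).sub (continuous_biotSavart hΦ hΦi hCΦ)
    refine (hωi.norm.mul_const (G * ‖V₀‖ + (CΦ + (4 * Real.pi)⁻¹ * ∫ x, ‖cross (gradient g x) V₀‖))).mono'
      (hωc.inner hc2).aestronglyMeasurable (Eventually.of_forall fun y => ?_)
    refine (norm_inner_le_norm _ _).trans (mul_le_mul_of_nonneg_left ?_ (norm_nonneg _))
    refine (norm_sub_le _ _).trans (add_le_add ?_ (norm_biotSavart_le hΦi hCΦ y))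
    rw [norm_smul]
    exact mul_le_mul_of_nonneg_right (hG y) (norm_nonneg _)
  rw [integral_sub i1 i2]

end BiotSavart

end Literature.Analysis.FluidPDE
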